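import Literature.NumberTheory.LFunctions.Zhang2022.ObjectiveTwinEllSlope
import Literature.NumberTheory.LFunctions.Zhang2022.MainTermFormCauchySchwarz

/-!
# Zhang (2022) design-space objective, twin part 4: the kernel Gram form IS the `L²` Gram of the AFE basis

Y. Zhang, *Discrete mean estimates and the Landau–Siegel zero*, arXiv:2211.02515v1 (2022)
[Zhang2022LandauSiegel] — an unrefereed manuscript under adjudication. **This file SEARCHES and TYPES; it
makes no claim about Landau–Siegel zeros, about Theorems 1–2 of the manuscript, or about a repaired (2.32),
until a kernel theorem says so.** Companion of `ObjectiveTwinEllSlope` (CONTROL item C2a of the LANDAU–SIEGEL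
programme's OBJECTIVE.md §5): there the Gram form `kernelGramQ x₁ x₂ x₃ = |x₁|² + |x₂|² + |x₃|² −
(4/π)·Im(x₁x̄₂ + x₂x̄₃)` of the pencil `(D_K, G_K)` was taken as a DEFINITION, its identification with the `L²[0,1]`
Gram matrix `G_K = I + (2/π)J` of the kernel basis `k_j = e^{−iπjy}` (`MainTermFormFrequencies.afeDir j`) being
cited from the certified record (repair/num-1 L11 §3, kit j251235). This file PROVES that identification in the
kernel:

* `afeDir_mul_conj_afeDir` — `k_a(y)·k̄_b(y) = e^{(c_a − c_b)y}`, hence `= k_{a−b}(y)` for `b ≤ a`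
  (`afeDir_mul_conj_afeDir_of_le`);
* `integral_afeDir_one/two` — `∫₀¹ k₁ = 2/(πi) = −2i/π`, `∫₀¹ k₂ = 0` (from `primitive_afeDir`; the diagonal
  products are `k_a k̄_a ≡ 1`, `afeDir_mul_conj`);
* **`integral_normSq_afeComb`** — for every `x ∈ ℂ³`,
  `∫₀¹ ‖x₁k₁(y) + x₂k₂(y) + x₃k₃(y)‖² dy = kernelGramQ x₁ x₂ x₃`.

So of the two inputs of C2a that `ObjectiveTwinEllSlope` cites rather than derives, ONE (the Gram side) is now a
kernel theorem; the other (the vanishing of the off-diagonal ℓ-slopes of `D_K`) remains the certified record.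
Elementary calculus; no new `Prop` facts about the manuscript.
-/

noncomputable section

open Real Complex ComplexConjugate MeasureTheory Set intervalIntegral

namespace Literature.NumberTheory.LFunctions.Zhang2022

namespace Objective

/-! ## Products of basis directions -/

/-- `c_a − c_b = c_{a−b}` for `b ≤ a` (`c_j = −iπj` is additive in `j`). [cite: Zhang2022LandauSiegel, §2 (2.13)] -/
theorem afeFreq_sub {a b : ℕ} (h : b ≤ a) : afeFreq a - afeFreq b = afeFreq (a - b) := by
  unfold afeFreq
  rw [Nat.cast_sub h]
  ring

/-- `k_a(y)·conj k_b(y) = exp((c_a − c_b)·y)`. [cite: Zhang2022LandauSiegel, §2 (2.13)] -/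
theorem afeDir_mul_conj_afeDir (a b : ℕ) (y : ℝ) :
    afeDir a y * conj (afeDir b y) = Complex.exp ((afeFreq a - afeFreq b) * y) := by
  unfold afeDir
  rw [← Complex.exp_conj, ← Complex.exp_add, map_mul, conj_afeFreq, Complex.conj_ofReal]
  ring_nf

/-- `k_a·k̄_b = k_{a−b}` for `b ≤ a`. [cite: Zhang2022LandauSiegel, §2 (2.13)] -/
theorem afeDir_mul_conj_afeDir_of_le {a b : ℕ} (h : b ≤ a) (y : ℝ) :
    afeDir a y * conj (afeDir b y) = afeDir (a - b) y := by
  rw [afeDir_mul_conj_afeDir, afeFreq_sub h, afeDir]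

/-- `k_b·k̄_a = conj k_{a−b}` for `b ≤ a`. [cite: Zhang2022LandauSiegel, §2 (2.13)] -/
theorem afeDir_mul_conj_afeDir_of_ge {a b : ℕ} (h : b ≤ a) (y : ℝ) :
    afeDir b y * conj (afeDir a y) = conj (afeDir (a - b) y) := by
  rw [← afeDir_mul_conj_afeDir_of_le h, map_mul, Complex.conj_conj, mul_comm]

/-- `k₀ ≡ 1`. [cite: Zhang2022LandauSiegel, §2 (2.13)] -/
theorem afeDir_zero_left (y : ℝ) : afeDir 0 y = 1 := by simp [afeDir, afeFreq]

/-! ## The three integrals -/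

/-- `∫₀¹ k₁ = 2/(πi)` (`= −2i/π`). [cite: Zhang2022LandauSiegel, §2 (2.13)] -/
theorem integral_afeDir_one : ∫ y in (0:ℝ)..1, afeDir 1 y = 2 / ((π : ℂ) * Complex.I) := by
  rw [primitive_afeDir one_ne_zero, afeDir_one]
  unfold afeFreq
  have hπ : (π : ℂ) ≠ 0 := Complex.ofReal_ne_zero.mpr Real.pi_ne_zero
  field_simp
  ring

/-- `∫₀¹ k₂ = 0`. [cite: Zhang2022LandauSiegel, §2 (2.13)] -/
theorem integral_afeDir_two : ∫ y in (0:ℝ)..1, afeDir 2 y = 0 := by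
  rw [primitive_afeDir two_ne_zero, afeDir_one]
  norm_num

/-- `∫₀¹ conj k_m = conj ∫₀¹ k_m`. [folklore] -/
private theorem integral_conj_afeDir (m : ℕ) :
    ∫ y in (0:ℝ)..1, conj (afeDir m y) = conj (∫ y in (0:ℝ)..1, afeDir m y) := by
  rw [intervalIntegral.integral_of_le zero_le_one, intervalIntegral.integral_of_le zero_le_one, integral_conj]

/-- interval integrability of the basis directions. [folklore] -/
private theorem ii_afeDir (m : ℕ) : IntervalIntegrable (afeDir m) volume 0 1 :=
  (continuous_afeDir m).intervalIntegrable 0 1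

/-- interval integrability of their conjugates. [folklore] -/
private theorem ii_conj_afeDir (m : ℕ) : IntervalIntegrable (fun y => conj (afeDir m y)) volume 0 1 :=
  (Complex.continuous_conj.comp (continuous_afeDir m)).intervalIntegrable 0 1

/-! ## The Gram identification -/

/-- Pointwise expansion of `|u|²` for `u = x₁k₁ + x₂k₂ + x₃k₃` into the constant, `k₁`, `k̄₁`, `k₂`, `k̄₂` modes.
[cite: Zhang2022LandauSiegel, §2 (2.13)] -/
theorem afeComb_mul_conj (x₁ x₂ x₃ : ℂ) (y : ℝ) :
    (x₁ * afeDir 1 y + x₂ * afeDir 2 y + x₃ * afeDir 3 y) *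
        conj (x₁ * afeDir 1 y + x₂ * afeDir 2 y + x₃ * afeDir 3 y) =
      (x₁ * conj x₁ + x₂ * conj x₂ + x₃ * conj x₃)
        + (x₂ * conj x₁ + x₃ * conj x₂) * afeDir 1 y
        + (x₁ * conj x₂ + x₂ * conj x₃) * conj (afeDir 1 y)
        + (x₃ * conj x₁) * afeDir 2 y + (x₁ * conj x₃) * conj (afeDir 2 y) := by
  have h11 := afeDir_mul_conj 1 y
  have h22 := afeDir_mul_conj 2 y
  have h33 := afeDir_mul_conj 3 y
  have h21 : afeDir 2 y * conj (afeDir 1 y) = afeDir 1 y := afeDir_mul_conj_afeDir_of_le (by norm_num) y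
  have h32 : afeDir 3 y * conj (afeDir 2 y) = afeDir 1 y := afeDir_mul_conj_afeDir_of_le (by norm_num) y
  have h31 : afeDir 3 y * conj (afeDir 1 y) = afeDir 2 y := afeDir_mul_conj_afeDir_of_le (by norm_num) y
  have h12 : afeDir 1 y * conj (afeDir 2 y) = conj (afeDir 1 y) := afeDir_mul_conj_afeDir_of_ge (by norm_num) y
  have h23 : afeDir 2 y * conj (afeDir 3 y) = conj (afeDir 1 y) := afeDir_mul_conj_afeDir_of_ge (by norm_num) y
  have h13 : afeDir 1 y * conj (afeDir 3 y) = conj (afeDir 2 y) := afeDir_mul_conj_afeDir_of_ge (by norm_num) y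
  simp only [map_add, map_mul]
  linear_combination (x₁ * conj x₁) * h11 + (x₂ * conj x₂) * h22 + (x₃ * conj x₃) * h33
    + (x₂ * conj x₁) * h21 + (x₃ * conj x₂) * h32 + (x₃ * conj x₁) * h31
    + (x₁ * conj x₂) * h12 + (x₂ * conj x₃) * h23 + (x₁ * conj x₃) * h13

/-- **The Gram form of `ObjectiveTwinEllSlope` IS the `L²[0,1]` Gram of the kernel basis**:
`∫₀¹ ‖x₁k₁ + x₂k₂ + x₃k₃‖² = |x₁|² + |x₂|² + |x₃|² − (4/π)·Im(x₁x̄₂ + x₂x̄₃) = kernelGramQ x₁ x₂ x₃`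
(`⟨k_a,k_b⟩ = 1, ∓2i/π, 0` for `|a−b| = 0, 1, 2`; record `G_K = I + (2/π)J`, repair/num-1 L11 §3).
[cite: Zhang2022LandauSiegel, §2 (2.10), (2.13)] -/
theorem integral_normSq_afeComb (x₁ x₂ x₃ : ℂ) :
    ∫ y in (0:ℝ)..1, ‖x₁ * afeDir 1 y + x₂ * afeDir 2 y + x₃ * afeDir 3 y‖ ^ 2 = kernelGramQ x₁ x₂ x₃ := by
  -- pass to the complex integral `∫ u ū`
  have key := intervalIntegral_mul_conj_self (fun y => x₁ * afeDir 1 y + x₂ * afeDir 2 y + x₃ * afeDir 3 y)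
  simp only [afeComb_mul_conj] at key
  -- integrate the five modes
  have I1 := integral_afeDir_one
  have I2 := integral_afeDir_two
  have I1c : ∫ y in (0:ℝ)..1, conj (afeDir 1 y) = conj (2 / ((π : ℂ) * Complex.I)) := by
    rw [integral_conj_afeDir, I1]
  have I2c : ∫ y in (0:ℝ)..1, conj (afeDir 2 y) = 0 := by rw [integral_conj_afeDir, I2, map_zero]
  have hA := (intervalIntegrable_const (μ := volume) (a := (0:ℝ)) (b := 1)
    (c := x₁ * conj x₁ + x₂ * conj x₂ + x₃ * conj x₃))
  have hB := (ii_afeDir 1).const_mul (x₂ * conj x₁ + x₃ * conj x₂)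
  have hC := (ii_conj_afeDir 1).const_mul (x₁ * conj x₂ + x₂ * conj x₃)
  have hD := (ii_afeDir 2).const_mul (x₃ * conj x₁)
  have hE := (ii_conj_afeDir 2).const_mul (x₁ * conj x₃)
  rw [intervalIntegral.integral_add (((hA.add hB).add hC).add hD) hE,
    intervalIntegral.integral_add ((hA.add hB).add hC) hD,
    intervalIntegral.integral_add (hA.add hB) hC,
    intervalIntegral.integral_add hA hB,
    intervalIntegral.integral_const_mul, intervalIntegral.integral_const_mul,
    intervalIntegral.integral_const_mul, intervalIntegral.integral_const_mul,
    intervalIntegral.integral_const, I1, I1c, I2, I2c] at key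
  -- compare real parts
  have hre := congrArg Complex.re key
  rw [Complex.ofReal_re] at hre
  rw [← hre, kernelGramQ]
  have hπ : (π : ℝ) ≠ 0 := Real.pi_ne_zero
  simp only [sub_zero, one_smul, Complex.add_re, Complex.mul_re, Complex.mul_im, Complex.conj_re, Complex.conj_im,
    Complex.add_im, Complex.div_re, Complex.div_im, Complex.I_re, Complex.I_im, Complex.ofReal_re, Complex.ofReal_im,
    Complex.normSq_apply, Complex.re_ofNat, Complex.im_ofNat, Complex.zero_re, Complex.sq_norm, mul_zero, zero_mul,
    mul_one]
  field_simp
  ring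

end Objective

end Literature.NumberTheory.LFunctions.Zhang2022
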